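import Summits.FinalStateConjecture.FinalStateConjecture.Theorems.PhaseMixingCaptureCaptureSufficesTameNoC0LimitLemmas
import HarnessLib

/-!
# NoC0KerrChart limit argument II: the flow property of the orbit and the continuation block

Crux `CaptureSufficesTame` (stmt-FinalStateConjecture-17270), line `only-the-third-law-is-generic`, NoC0KerrChart
programme, lead c10. Registered sub-goal of this file: `stub_noC0_orbitFlow` (`NoC0.orbit_flow`).

`NoC0.lr_block` is the continuation block of the limit argument: if the level-`n` generator segments `μ_n` converge
pointwise to `y` on `[T, T + h₀]` with `y T = Γ T` on the photon orbit, and orbit points `Γ s`, `s ∈ [T − s₀, T]`, are limits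
of points of `C_n`, then `y = Γ` on a definite `[T, T + h]`. Ingredients: local closedness of `≤`
(`exists_nhds_causalRelation_closed`), the local radial representation of the Kerr exterior
(`NoC0.exists_radial_representation`), the null corner lemma (`mem_chronologicalFuture_of_corner`), the flow property
(`orbit_flow`), and `transplant_contra`. No injectivity of the exponential map and no cut-locus analysis is used: the
corner is taken AT THE ORBIT, whose tangent is known.

References: B. O'Neill, *Semi-Riemannian geometry* (1983), Ch. 10, Prop. 10.46; Ch. 14, Lemma 14.2
(key `ONeillSemiRiemannian1983`); J. M. Lee, *Introduction to Riemannian Manifolds* (2018), Lemma 5.18, Thm. 4.27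
(key `LeeRiemannianManifolds2018`).
-/

set_option linter.dupNamespace false
set_option maxSynthPendingDepth 3

noncomputable section

open Set Filter Function Bundle MeasureTheory Metric
open scoped Manifold ContDiff Topology ENNReal

namespace Summit.FinalStateConjecture.FinalStateConjecture.Theorems.PhaseMixingCaptureCaptureSufficesTame

open Literature.Geometry.Lorentzian Literature.Geometry.Riemannian

namespace NoC0

variable {M a : ℝ}

/-- **Flow property along the photon orbit**: the orbit is a complete geodesic of the exterior, so for every
parameter `s` and every `c` the vector `c • γ'(s)` is in the domain of `exp_{γ s}` and `exp_{γ s}(c • γ'(s)) = γ (s + c)`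
(Lee 2018, Lemma 5.18 / Thm. 4.27, flow property of maximal geodesics). [cite: LeeRiemannianManifolds2018, Lemma 5.18] -/
theorem orbit_flow (M a r₀ : ℝ) [Kerr.Facts] [Kerr.SliceFacts] (hM : 0 < M) (ha0 : 0 ≤ a) (haM : a ≤ M)
    (h3 : 3 * M ≤ r₀) (hcubic : r₀ * (r₀ - 3 * M) ^ 2 = 4 * a ^ 2 * M)
    (hmem' : ∀ s, Kerr.orbitCurve a r₀ √(M / r₀ ^ 3) s ∈ Kerr.exterior M a) (s c : ℝ) :
    ((c • (velocity 𝓘(ℝ, E4) (fun u ↦ (⟨Kerr.orbitCurve a r₀ √(M / r₀ ^ 3) u, hmem' u⟩ : Kerr.region a (Kerr.rPlus M a))) s : E4)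
        : E4) : TangentSpace 𝓘(ℝ, E4) ((⟨Kerr.orbitCurve a r₀ √(M / r₀ ^ 3) s, hmem' s⟩ : Kerr.region a (Kerr.rPlus M a)))) ∈
      expDomain (Kerr.smoothMetric M a (Kerr.rPlus M a)).leviCivita
        ((⟨Kerr.orbitCurve a r₀ √(M / r₀ ^ 3) s, hmem' s⟩ : Kerr.region a (Kerr.rPlus M a))) ∧
    expMap (Kerr.smoothMetric M a (Kerr.rPlus M a)).leviCivita
        ((⟨Kerr.orbitCurve a r₀ √(M / r₀ ^ 3) s, hmem' s⟩ : Kerr.region a (Kerr.rPlus M a)))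
        ((c • (velocity 𝓘(ℝ, E4) (fun u ↦ (⟨Kerr.orbitCurve a r₀ √(M / r₀ ^ 3) u, hmem' u⟩ : Kerr.region a (Kerr.rPlus M a))) s : E4)
          : E4) : TangentSpace 𝓘(ℝ, E4) ((⟨Kerr.orbitCurve a r₀ √(M / r₀ ^ 3) s, hmem' s⟩ : Kerr.region a (Kerr.rPlus M a)))) =
      ⟨Kerr.orbitCurve a r₀ √(M / r₀ ^ 3) (s + c), hmem' (s + c)⟩ := by
  haveI := LorentzianMetric.contMDiffCovariantDerivative_leviCivita_one (Kerr.smoothMetric M a (Kerr.rPlus M a))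
  set cov := (Kerr.smoothMetric M a (Kerr.rPlus M a)).leviCivita with hcov
  set γK : ℝ → Kerr.region a (Kerr.rPlus M a) := fun u ↦ ⟨Kerr.orbitCurve a r₀ √(M / r₀ ^ 3) u, hmem' u⟩ with hγK
  obtain ⟨-, hgeo, -, -⟩ := kerr_orbitCurve_isGeodesic_null M a r₀ hM ha0 haM h3 hcubic hmem'
  obtain ⟨ℓ, hℓ⟩ : ∃ ℓ : E4, velocity 𝓘(ℝ, E4) γK 0 = ℓ := ⟨_, rfl⟩
  obtain ⟨hdomK, heqK⟩ := subset_maximalGeodesicDomain_of_isGeodesicOn (cov := cov) isOpen_univ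
    Set.ordConnected_univ (mem_univ 0) hgeo (x := γK 0) (v := ℓ) rfl hℓ
  have hγKmax : maximalGeodesic cov (γK 0) ℓ = γK := (funext fun u ↦ heqK (mem_univ u)).symm
  -- the geodesic issuing from the tangent lift of the orbit at `s` is the translated orbit, with domain `ℝ`
  have hflow := maximalGeodesicDomain_tangentLift_eq (cov := cov)
    (⟨γK 0, ℓ⟩ : TangentBundle 𝓘(ℝ, E4) (Kerr.region a (Kerr.rPlus M a))) (s := s) (hdomK (mem_univ s))
  simp only [tangentLift_proj, tangentLift_snd] at hflow
  have gen : ∀ μ : ℝ → Kerr.region a (Kerr.rPlus M a), maximalGeodesic cov (γK 0) ℓ = μ →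
      maximalGeodesicDomain cov (μ s) (velocity 𝓘(ℝ, E4) μ s) = {t | t + s ∈ maximalGeodesicDomain cov (γK 0) ℓ} ∧
      EqOn (fun t ↦ μ (t + s)) (maximalGeodesic cov (μ s) (velocity 𝓘(ℝ, E4) μ s))
        {t | t + s ∈ maximalGeodesicDomain cov (γK 0) ℓ} := by
    rintro μ rfl; exact hflow
  obtain ⟨hdomEq, hEqOn⟩ := gen γK hγKmax
  have hc : c ∈ maximalGeodesicDomain cov (γK s) (velocity 𝓘(ℝ, E4) γK s) := by
    rw [hdomEq]; exact hdomK (mem_univ _)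
  obtain ⟨h1, h2⟩ := expMap_smul_of_mem (cov := cov) (γK s) (velocity 𝓘(ℝ, E4) γK s) hc
  refine ⟨h1, h2.trans ?_⟩
  rw [← hEqOn (show c + s ∈ maximalGeodesicDomain cov (γK 0) ℓ from hdomK (mem_univ _)), add_comm]

set_option maxHeartbeats 400000 in
/-- **The continuation block of the NoC0KerrChart limit argument.** Along the filter `l`, let `μ_n` be
`t*`-parametrised `B_n`-causal generator segments on `[T, T + h₀]` with points in `C_n ∖ O_n`, converging pointwise to
`y`, with `y T = Γ T` on the photon orbit `Γ`, and let the orbit points `Γ s`, `s ∈ [T − s₀, T]`, be limits of points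
of `C_n`. Then `y = Γ` on a definite interval `[T, T + h]`: by local closedness of `≤` the limit point `Y = y t` is in
`J⁺(P)`, `P = Γ T`; the radial vector `v = exp_P⁻¹ Y` of the local time-separation package is future causal, and not
timelike (a timelike radial geodesic, transplanted by (TL) to a `B_n`-timelike curve from `μ_n T ∈ C_n` to `μ_n t`, would
put `μ_n t ∈ O_n`); if `v` made a corner with the orbit at `P`, `Y ∈ I⁺(Γ (T − eσ))` (`mem_chronologicalFuture_of_corner`)
and the same transplant from the anchors at `Γ (T − eσ)` gives the contradiction; so `v ∥ Γ'(P)` and the flow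
property puts `Y` on the orbit, where `t*` pins it to `Γ t`. [cite: ONeillSemiRiemannian1983, Ch. 10, Prop. 10.46] -/
theorem lr_block (M a : ℝ) [Kerr.Facts] [Kerr.SliceFacts] (hM : 0 < M) (ha0 : 0 ≤ a) (haM : a ≤ M)
    (r₀ q e S : ℝ) (h3 : 3 * M ≤ r₀) (hcubic : r₀ * (r₀ - 3 * M) ^ 2 = 4 * a ^ 2 * M)
    (hq : q = √(M / r₀ ^ 3)) (he : e = 1 - a * q) (hS : S = 2 * Real.pi / q) (he0 : 0 < e) (hq0' : 0 < q)
    (Ω : Set E4) (hΩext : closure Ω ⊆ (Kerr.exterior M a : Set E4))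
    (η₀ : ℝ) (hη₀ : 0 < η₀)
    (htube : cthickening η₀ (Kerr.orbitCurve a r₀ q '' Icc (-S) (2 * S)) ⊆ Ω)
    (hH : ∀ y ∈ cthickening η₀ (Kerr.orbitCurve a r₀ q '' Icc (-S) (2 * S)), Kerr.scalarH M a y ≤ 2 / 5)
    (hDL3 : ∀ (M a : ℝ) (x v : E4) (B : E4 →L[ℝ] E4 →L[ℝ] ℝ) (ε κ : ℝ), 0 ≤ M → Kerr.scalarH M a x ≤ 2 / 5 →
      ‖B - Kerr.bilin M a x‖ ≤ ε → ε ≤ 1 / 80 → B v v ≤ 0 → v 0 = 1 → 0 ≤ κ →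
      Kerr.bilin M a x (v + κ • E4.basisVector 0) (v + κ • E4.basisVector 0) ≤ 4 * ε - κ / 10)
    (hTL : ∀ (M a : ℝ) (K₁ : Set E4) (δ₀ : ℝ), 0 ≤ M → IsCompact K₁ → 0 < δ₀ →
      cthickening δ₀ K₁ ⊆ (Kerr.exterior M a : Set E4) →
      ∀ (c c' : ℝ → E4) (L : ℝ), 0 < L → (∀ r ∈ Icc 0 L, HasDerivAt c (c' r) r) → ContinuousOn c' (Icc 0 L) →
      (∀ r ∈ Icc 0 L, c r ∈ K₁ ∧ Kerr.bilin M a (c r) (c' r) (c' r) < 0 ∧ 0 < c' r 0) →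
      ∃ δ > 0, δ ≤ δ₀ ∧ ∀ (z₁ z₂ : E4), ‖z₁‖ < δ → ‖z₂‖ < δ → ∀ B : E4 → E4 →L[ℝ] E4 →L[ℝ] ℝ,
        (∀ y ∈ cthickening δ₀ K₁, ‖B y - Kerr.bilin M a y‖ < δ) →
        ∀ r ∈ Icc 0 L, c r + (1 - r / L) • z₁ + (r / L) • z₂ ∈ thickening δ₀ K₁ ∧
          HasDerivAt (fun r ↦ c r + (1 - r / L) • z₁ + (r / L) • z₂) (c' r + (1 / L) • (z₂ - z₁)) r ∧
          B (c r + (1 - r / L) • z₁ + (r / L) • z₂) (c' r + (1 / L) • (z₂ - z₁)) (c' r + (1 / L) • (z₂ - z₁)) < 0 ∧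
          0 < (c' r + (1 / L) • (z₂ - z₁)) 0)
    {l : Filter ℕ} [l.NeBot] (ε : ℕ → ℝ) (hε0 : ∀ n, 0 ≤ ε n) (hε4 : ∀ n, ε n ≤ 1 / 80)
    (hεl : Tendsto ε l (𝓝 0))
    (B : ℕ → E4 → E4 →L[ℝ] E4 →L[ℝ] ℝ) (hB : ∀ n, ∀ y ∈ Ω, ‖B n y - Kerr.bilin M a y‖ ≤ ε n)
    (C O : ℕ → Set E4) (hCΩ : ∀ n, C n ⊆ Ω)
    (hD : ∀ n, ∀ y ∈ C n, ∀ z ∈ Ω, (∃ (c : ℝ → E4) (s₁ s₂ : ℝ), s₁ < s₂ ∧ c s₁ = y ∧ c s₂ = z ∧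
      ∀ t ∈ Icc s₁ s₂, c t ∈ Ω ∧ ∃ v : E4, HasDerivAt c v t ∧ B n (c t) v v < 0 ∧ 0 < v 0) → z ∈ O n)
    (T h₀ s₀ : ℝ) (hT0 : 0 ≤ T) (hh₀ : 0 < h₀) (hTS : T + h₀ ≤ 3 / 2 * (e * S)) (hs₀ : 0 < s₀)
    (μ : ℕ → ℝ → E4)
    (hμ : ∀ᶠ n in l, ∀ s ∈ Icc T (T + h₀), μ n s ∈ C n ∧ μ n s ∉ O n ∧ μ n s 0 = s ∧
      ∃ v : E4, HasDerivAt (μ n) v s ∧ B n (μ n s) v v ≤ 0 ∧ v 0 = 1)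
    (y : ℝ → E4) (hy : ∀ t ∈ Icc T (T + h₀), Tendsto (fun n ↦ μ n t) l (𝓝 (y t)))
    (hyT : y T = Kerr.orbitCurve a r₀ q (T / e))
    (hanch : ∀ s ∈ Icc (T - s₀) T, ∃ b : ℕ → E4, (∀ᶠ n in l, b n ∈ C n) ∧
      Tendsto b l (𝓝 (Kerr.orbitCurve a r₀ q (s / e)))) :
    ∃ h, 0 < h ∧ h ≤ h₀ ∧ ∀ t ∈ Icc T (T + h), y t = Kerr.orbitCurve a r₀ q (t / e) := by
  subst hq
  haveI : Fact ((1 : ℕ∞ω) ≤ (∞ : ℕ∞ω)) := ⟨by exact_mod_cast le_top⟩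
  haveI := LorentzianMetric.contMDiffCovariantDerivative_leviCivita_one (Kerr.smoothMetric M a (Kerr.rPlus M a))
  set τK := (Kerr.exteriorSpacetime M a hM.le).timeOrientation with hτK
  have hΩext' : Ω ⊆ (Kerr.exterior M a : Set E4) := subset_closure.trans hΩext
  /- ── orbit data ── -/
  have hr₀ : 0 < r₀ := by linarith
  have hrp : Kerr.rPlus M a < r₀ := (Kerr.rPlus_le_two_mul hM.le).trans_lt (by linarith)
  have hmem : ∀ s, Kerr.orbitCurve a r₀ √(M / r₀ ^ 3) s ∈ Kerr.exterior M a := fun s ↦ by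
    rw [Kerr.mem_exterior, Kerr.radius_orbitCurve hr₀]; exact max_lt hrp hr₀
  set γK : ℝ → Kerr.region a (Kerr.rPlus M a) := fun s ↦ ⟨Kerr.orbitCurve a r₀ √(M / r₀ ^ 3) s, hmem s⟩ with hγK
  obtain ⟨-, -, -, hvel⟩ := kerr_orbitCurve_isGeodesic_null M a r₀ hM ha0 haM h3 hcubic hmem
  have htime : ∀ s, Kerr.orbitCurve a r₀ √(M / r₀ ^ 3) s 0 = e * s := fun s ↦ by
    rw [Kerr.orbitCurve_apply_zero, he]
  have hq2 : √(M / r₀ ^ 3) ^ 2 * r₀ ^ 3 = M := by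
    rw [Real.sq_sqrt (by positivity)]; field_simp
  have hS0 : 0 < S := by rw [hS]; positivity
  have horbit : (Kerr.smoothMetric M a (Kerr.rPlus M a)).IsFutureCausalCurveOn τK γK univ :=
    isFutureCausalCurveOn_liftCurve (a := a) hM.le hmem (s := univ)
      (v := fun s ↦ Kerr.orbitVel a √(M / r₀ ^ 3) (Kerr.orbitCurve a r₀ √(M / r₀ ^ 3) s))
      (fun s _ ↦ Kerr.hasDerivAt_orbitCurve s)
      (fun s _ ↦ (Kerr.bilin_orbitVel_self hM ha0 h3 hq0'.le hq2 hcubic s).le)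
      (fun s _ ↦ by rw [Kerr.orbitVel_apply_zero, ← he]; exact he0)
  have horbkin := orbit_norm_sub_le M a r₀ e hM ha0 h3 hcubic he he0
  /- ── kinematics of the generators ── -/
  have hkin : ∀ᶠ n in l, ∀ s ∈ Icc T (T + h₀), ‖μ n s - μ n T‖ ≤ 2 * (s - T) := by
    filter_upwards [hμ] with n hn
    intro s hs
    have h := (kerr_time_strictMonoOn_and_norm_sub_le M a (fun s ↦ B n (μ n s)) (μ n) T s hM.le hs.1
      (fun s' hs' ↦ ?_)).2
    · obtain ⟨-, -, h0s, -⟩ := hn s hs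
      obtain ⟨-, -, h0T, -⟩ := hn T (left_mem_Icc.2 (by linarith))
      rwa [h0s, h0T] at h
    · have hs'' : s' ∈ Icc T (T + h₀) := ⟨hs'.1, hs'.2.trans hs.2⟩
      obtain ⟨hC, -, -, v, hv, hBv, hv0⟩ := hn s' hs''
      exact ⟨(hB n _ (hCΩ n hC)).trans (by linarith [hε4 n]), v, hv, hBv, by rw [hv0]; exact one_pos⟩
  /- ── the base point and its packages ── -/
  set PK : Kerr.region a (Kerr.rPlus M a) := γK (T / e) with hPK
  have hPcoe : (PK : E4) = Kerr.orbitCurve a r₀ √(M / r₀ ^ 3) (T / e) := rfl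
  have hP0 : (PK : E4) 0 = T := by rw [hPcoe, htime]; field_simp
  obtain ⟨ρ₁, Ξ, hρ₁, hERR⟩ := exists_radial_representation (a := a) hM.le PK
  obtain ⟨W₂, hW₂o, hPW₂, hcl⟩ :=
    LorentzianMetric.exists_nhds_causalRelation_closed (g := Kerr.smoothMetric M a (Kerr.rPlus M a)) τK le_rfl PK
  obtain ⟨ρ₂, hρ₂, hball₂⟩ := Metric.isOpen_iff.1 hW₂o PK hPW₂
  have hρW : ∀ y' : Kerr.exterior M a, ‖(y' : E4) - PK‖ < ρ₂ → y' ∈ W₂ := fun y' hy' ↦ hball₂ (by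
    rw [Metric.mem_ball]; change dist (y' : E4) (PK : E4) < ρ₂; rwa [dist_eq_norm])
  have hT2 : T ≤ 2 * (e * S) := by linarith
  have htubeP : ∀ z : E4, ‖z - PK‖ ≤ η₀ → z ∈ cthickening η₀ (Kerr.orbitCurve a r₀ √(M / r₀ ^ 3) '' Icc (-S) (2 * S)) :=
    fun z hz ↦ mem_orbitTube he0 hS0.le T z hT0 hT2 hz
  have hextP : ∀ z : E4, ‖z - PK‖ ≤ η₀ → z ∈ Kerr.exterior M a := fun z hz ↦ hΩext' (htube (htubeP z hz))
  have hHP : ∀ z : E4, ‖z - PK‖ ≤ η₀ → Kerr.scalarH M a z ≤ 2 / 5 := fun z hz ↦ hH z (htubeP z hz)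
  have hthick : ∀ A : Set E4, (∀ z ∈ A, ‖z - PK‖ ≤ η₀ / 2) → cthickening (η₀ / 2) A ⊆ Ω := fun A hA ↦
    cthickening_subset_of_near_orbit he0 hS0.le hη₀ htube A fun z hz ↦ ⟨T, hT0, hT2, hA z hz⟩
  /- ── the radius and the step ── -/
  obtain ⟨ρ, hρdef⟩ : ∃ ρ : ℝ, ρ = min (min ρ₁ ρ₂) η₀ := ⟨_, rfl⟩
  have hρ : 0 < ρ := by rw [hρdef]; exact lt_min (lt_min hρ₁ hρ₂) hη₀
  have hρ1 : ρ ≤ ρ₁ := by rw [hρdef]; exact (min_le_left _ _).trans (min_le_left _ _)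
  have hρ2 : ρ ≤ ρ₂ := by rw [hρdef]; exact (min_le_left _ _).trans (min_le_right _ _)
  have hρη : ρ ≤ η₀ := by rw [hρdef]; exact min_le_right _ _
  obtain ⟨h, hhdef⟩ : ∃ h : ℝ, h = min h₀ (ρ / 40) := ⟨_, rfl⟩
  have hh : 0 < h := by rw [hhdef]; exact lt_min hh₀ (by positivity)
  have hhh₀ : h ≤ h₀ := by rw [hhdef]; exact min_le_left _ _
  have hhρ : 40 * h ≤ ρ := by have := min_le_right h₀ (ρ / 40); rw [← hhdef] at this; linarith
  refine ⟨h, hh, hhh₀, fun t htI ↦ ?_⟩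
  rcases htI.1.eq_or_lt with rfl | hTt
  · exact hyT
  have htI₀ : t ∈ Icc T (T + h₀) := ⟨htI.1, htI.2.trans (by linarith)⟩
  have hTI₀ : T ∈ Icc T (T + h₀) := left_mem_Icc.2 (by linarith)
  obtain ⟨Y, hYdef⟩ : ∃ Y : E4, y t = Y := ⟨_, rfl⟩
  rw [hYdef]
  have hYlim : Tendsto (fun n ↦ μ n t) l (𝓝 Y) := hYdef ▸ hy t htI₀
  have hPlim : Tendsto (fun n ↦ μ n T) l (𝓝 (PK : E4)) := by rw [hPcoe, ← hyT]; exact hy T hTI₀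
  have hμT : ∀ᶠ n in l, ‖μ n T - PK‖ < h :=
    (tendsto_iff_norm_sub_tendsto_zero.1 hPlim).eventually (gt_mem_nhds hh)
  have hcoord : Continuous fun z : E4 ↦ z 0 := (EuclideanSpace.proj (0 : Fin 4)).continuous
  have hY0 : Y 0 = t := by
    have h1 : Tendsto (fun n ↦ μ n t 0) l (𝓝 (Y 0)) := (hcoord.tendsto Y).comp hYlim
    have h2 : ∀ᶠ n in l, t = μ n t 0 := by
      filter_upwards [hμ] with n hn; exact ((hn t htI₀).2.2.1).symm
    exact tendsto_nhds_unique h1 (tendsto_const_nhds.congr' h2)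
  have hμt3 : ∀ᶠ n in l, ‖μ n t - PK‖ < 3 * h := by
    filter_upwards [hkin, hμT] with n hk hT'
    calc ‖μ n t - PK‖ ≤ ‖μ n t - μ n T‖ + ‖μ n T - PK‖ := norm_sub_le_norm_sub_add_norm_sub _ _ _
      _ < 2 * (t - T) + h := add_lt_add_of_le_of_lt (hk t htI₀) hT'
      _ ≤ 3 * h := by linarith [htI.2]
  have hYP : ‖Y - PK‖ ≤ 3 * h :=
    le_of_tendsto ((hYlim.sub_const _).norm) (hμt3.mono fun n hn ↦ hn.le)
  have hYcl : Y ∈ closure Ω :=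
    mem_closure_of_tendsto hYlim (by filter_upwards [hμ] with n hn; exact hCΩ n (hn t htI₀).1)
  have hYext : Y ∈ Kerr.exterior M a := hΩext hYcl
  set YK : Kerr.region a (Kerr.rPlus M a) := ⟨Y, hYext⟩ with hYK
  /- ── (a) `Y ∈ J⁺(P)` by local closedness of `≤` ── -/
  have hYJ : YK ∈ (Kerr.smoothMetric M a (Kerr.rPlus M a)).causalFuture τK {PK} := by
    have hdr : Tendsto (fun k ↦ (50 * ε k * (t - T)) • E4.basisVector 0) l (𝓝 0) := by
      have := ((hεl.const_mul 50).mul_const (t - T)).smul_const (E4.basisVector 0)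
      simpa using this
    refine limit_mem_causalFuture (a := a) hM.le hDL3 (PK : E4) W₂ hcl ρ
      (fun y' hy' ↦ hρW y' (hy'.trans_le hρ2)) (fun z hz ↦ hextP z (hz.le.trans hρη)) ε hε0 hε4 B μ
      (fun _ ↦ T) (fun _ ↦ t) (Eventually.of_forall fun _ ↦ hTt.le) ?_ PK YK (by simp [hρ])
      (show ‖Y - PK‖ < ρ by linarith) hPlim (by simpa using hYlim.add hdr)
    filter_upwards [hμ, hkin, hμT] with k hk hkk hkT
    intro s hs
    have hs₀ : s ∈ Icc T (T + h₀) := ⟨hs.1, hs.2.trans htI₀.2⟩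
    obtain ⟨hC, -, -, v, hv, hBv, hv0⟩ := hk s hs₀
    have hsP : ‖μ k s - PK‖ < 3 * h := by
      calc ‖μ k s - PK‖ ≤ ‖μ k s - μ k T‖ + ‖μ k T - PK‖ := norm_sub_le_norm_sub_add_norm_sub _ _ _
        _ < 2 * (s - T) + h := add_lt_add_of_le_of_lt (hkk s hs₀) hkT
        _ ≤ 3 * h := by linarith [hs.2, htI.2]
    have hdrift : ‖(50 * ε k * (s - T)) • E4.basisVector 0‖ ≤ h := by
      have hsT : 0 ≤ s - T := by linarith [hs.1]
      have hsT' : s - T ≤ h := by linarith [hs.2, htI.2]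
      rw [norm_smul, show ‖E4.basisVector 0‖ = 1 by simp [E4.basisVector], mul_one, Real.norm_eq_abs,
        abs_of_nonneg (by have := hε0 k; positivity)]
      have := hε4 k
      have := hε0 k
      nlinarith
    refine ⟨hHP _ (by linarith), hB k _ (hCΩ k hC), ?_, v, hv, hBv, hv0⟩
    calc ‖μ k s + (50 * ε k * (s - T)) • E4.basisVector 0 - PK‖
        ≤ ‖μ k s - PK‖ + ‖(50 * ε k * (s - T)) • E4.basisVector 0‖ := by
          rw [add_sub_right_comm]; exact norm_add_le _ _
      _ < 3 * h + h := add_lt_add_of_lt_of_le hsP hdrift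
      _ ≤ ρ := by linarith
  /- ── (r) the radial vector `v = exp_P⁻¹ Y` ── -/
  have hUP : ‖((PK : Kerr.exterior M a) : E4) - PK‖ + 2 * |((PK : Kerr.exterior M a) : E4) 0 - (PK : E4) 0| < ρ₁ := by
    simp [hρ₁]
  have hUY : ‖((YK : Kerr.exterior M a) : E4) - PK‖ + 2 * |((YK : Kerr.exterior M a) : E4) 0 - (PK : E4) 0| < ρ₁ := by
    change ‖Y - PK‖ + 2 * |Y 0 - (PK : E4) 0| < ρ₁
    rw [hY0, hP0, abs_of_pos (by linarith)]
    linarith [htI.2]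
  have hne : YK ≠ PK := fun heq ↦ by
    have : (YK : E4) 0 = (PK : E4) 0 := by rw [heq]
    change Y 0 = _ at this
    rw [hY0, hP0] at this; linarith
  obtain ⟨v, hvdom, hvexp, hvfut, hvtime⟩ : ∃ v : E4,
      (v : TangentSpace 𝓘(ℝ, E4) PK) ∈ expDomain (Kerr.smoothMetric M a (Kerr.rPlus M a)).leviCivita PK ∧ expMap (Kerr.smoothMetric M a (Kerr.rPlus M a)).leviCivita PK (v : TangentSpace 𝓘(ℝ, E4) PK) = YK ∧
      τK.IsFutureDirected (x := PK) v ∧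
      (YK ∈ (Kerr.smoothMetric M a (Kerr.rPlus M a)).chronologicalFuture τK {PK} →
        (Kerr.smoothMetric M a (Kerr.rPlus M a)).IsTimelike (x := PK) v) :=
    ⟨_, hERR PK YK hUP hUY hYJ hne⟩
  /- ── (b) `v` is not timelike ── -/
  have hvnt : ¬ (Kerr.smoothMetric M a (Kerr.rPlus M a)).IsTimelike (x := PK) v := by
    intro hvt
    obtain ⟨β, β', hβ'c, hβ0, hβ1, hβ⟩ := radial_coordCurve (a := a) hM.le PK v hvdom hvt hvfut
    have hβ1' : β 1 = Y := by rw [hβ1]; exact congrArg Subtype.val hvexp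
    have hβkin : ∀ r ∈ Icc (0:ℝ) 1, ‖β r - PK‖ ≤ 2 * h := by
      intro r hr
      have hK := kerr_time_strictMonoOn_and_norm_sub_le M a (fun r ↦ Kerr.bilin M a (β r)) β 0 1 hM.le zero_le_one
        (fun r' hr' ↦ ⟨by simp, β' r', (hβ r' hr').2.1, (hβ r' hr').2.2.1.le, (hβ r' hr').2.2.2⟩)
      have hK' := (kerr_time_strictMonoOn_and_norm_sub_le M a (fun r ↦ Kerr.bilin M a (β r)) β 0 r hM.le hr.1
        (fun r' hr' ↦ ⟨by simp, β' r', (hβ r' ⟨hr'.1, hr'.2.trans hr.2⟩).2.1,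
          (hβ r' ⟨hr'.1, hr'.2.trans hr.2⟩).2.2.1.le, (hβ r' ⟨hr'.1, hr'.2.trans hr.2⟩).2.2.2⟩)).2
      have hmono : β r 0 ≤ β 1 0 := hK.1.monotoneOn hr (right_mem_Icc.2 zero_le_one) hr.2
      rw [hβ0] at hK'
      rw [hβ1', hY0] at hmono
      rw [hP0] at hK'
      linarith [htI.2]
    have hthickβ : cthickening (η₀ / 2) (β '' Icc 0 1) ⊆ Ω := hthick _ (by
      rintro z ⟨r, hr, rfl⟩; linarith [hβkin r hr])
    exact transplant_contra (a := a) hM.le hΩext' hTL hεl hB hD β β' hβ'c (fun r hr ↦ (hβ r hr).2) (half_pos hη₀)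
      hthickβ (fun n ↦ μ n T) (fun n ↦ μ n t) (by rw [hβ0]; exact hPlim) (by rw [hβ1']; exact hYlim)
      (by filter_upwards [hμ] with n hn; exact (hn T hTI₀).1)
      (by filter_upwards [hμ] with n hn; exact (hn t htI₀).2.1)
  /- ── (c) no corner with the orbit at `P` ── -/
  obtain ⟨σ, hσdef⟩ : ∃ σ : ℝ, σ = min (s₀ / e) (min (S / 2) (ρ / (40 * e))) := ⟨_, rfl⟩
  have hσ : 0 < σ := by rw [hσdef]; exact lt_min (by positivity) (lt_min (by positivity) (by positivity))
  have hσs₀ : e * σ ≤ s₀ := by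
    calc e * σ ≤ e * (s₀ / e) := by gcongr; rw [hσdef]; exact min_le_left _ _
      _ = s₀ := by field_simp
  have hσS : σ ≤ S / 2 := by rw [hσdef]; exact (min_le_right _ _).trans (min_le_left _ _)
  have hσρ : e * σ ≤ ρ / 40 := by
    calc e * σ ≤ e * (ρ / (40 * e)) := by gcongr; rw [hσdef]; exact (min_le_right _ _).trans (min_le_right _ _)
      _ = ρ / 40 := by field_simp
  have heσ : 0 < e * σ := mul_pos he0 hσ
  set QK : Kerr.region a (Kerr.rPlus M a) := γK (T / e - σ) with hQK
  have hQ0 : (QK : E4) 0 = T - e * σ := by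
    change Kerr.orbitCurve a r₀ √(M / r₀ ^ 3) (T / e - σ) 0 = _
    rw [htime, mul_sub, mul_div_cancel₀ _ he0.ne']
  have hQP : ‖(QK : E4) - PK‖ ≤ 2 * (e * σ) := by
    have := horbkin (T / e - σ) (T / e) (by linarith)
    rw [norm_sub_rev]
    change ‖Kerr.orbitCurve a r₀ √(M / r₀ ^ 3) (T / e) - Kerr.orbitCurve a r₀ √(M / r₀ ^ 3) (T / e - σ)‖ ≤ _
    linarith
  by_cases hcol : ∃ c : ℝ, 0 < c ∧
      (velocity 𝓘(ℝ, E4) (fun r : ℝ ↦ expMap (Kerr.smoothMetric M a (Kerr.rPlus M a)).leviCivita PK ((r • v : E4) : TangentSpace 𝓘(ℝ, E4) PK)) 0 : E4) =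
        c • (velocity 𝓘(ℝ, E4) γK (T / e) : E4)
  swap
  · exfalso
    have hγ₂ := LorentzianMetric.isFutureCausalCurveOn_expMap_smul (g := Kerr.smoothMetric M a (Kerr.rPlus M a)) τK hvdom hvfut
    have hjoin : γK (T / e) = (fun r : ℝ ↦ expMap (Kerr.smoothMetric M a (Kerr.rPlus M a)).leviCivita PK ((r • v : E4) : TangentSpace 𝓘(ℝ, E4) PK)) 0 := by
      simp only [zero_smul]; exact (expMap_zero (cov := (Kerr.smoothMetric M a (Kerr.rPlus M a)).leviCivita) PK).symm
    have hI := LorentzianMetric.mem_chronologicalFuture_of_corner (g := Kerr.smoothMetric M a (Kerr.rPlus M a)) (τ := τK)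
      (by exact_mod_cast le_top) (by linarith : T / e - σ < T / e) zero_lt_one
      (horbit.mono (subset_univ _)) hγ₂ hjoin hcol
    have hI' : YK ∈ (Kerr.smoothMetric M a (Kerr.rPlus M a)).chronologicalFuture τK {QK} := by
      have h2 : YK = expMap (Kerr.smoothMetric M a (Kerr.rPlus M a)).leviCivita PK
          (((1 : ℝ) • v : E4) : TangentSpace 𝓘(ℝ, E4) PK) := by
        rw [one_smul]; exact hvexp.symm
      rw [h2]; exact hI
    have hUQ : ‖((QK : Kerr.exterior M a) : E4) - PK‖ + 2 * |((QK : Kerr.exterior M a) : E4) 0 - (PK : E4) 0| < ρ₁ := by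
      rw [hQ0, hP0, show T - e * σ - T = -(e * σ) by ring, abs_neg, abs_of_pos heσ]
      linarith
    have hneQ : YK ≠ QK := fun heq ↦ by
      have : (YK : E4) 0 = (QK : E4) 0 := by rw [heq]
      rw [hQ0] at this
      change Y 0 = _ at this
      rw [hY0] at this; linarith
    obtain ⟨u, hudom, huexp, hufut, hutime⟩ : ∃ u : E4,
        (u : TangentSpace 𝓘(ℝ, E4) QK) ∈ expDomain (Kerr.smoothMetric M a (Kerr.rPlus M a)).leviCivita QK ∧ expMap (Kerr.smoothMetric M a (Kerr.rPlus M a)).leviCivita QK (u : TangentSpace 𝓘(ℝ, E4) QK) = YK ∧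
        τK.IsFutureDirected (x := QK) u ∧
        (YK ∈ (Kerr.smoothMetric M a (Kerr.rPlus M a)).chronologicalFuture τK {QK} →
          (Kerr.smoothMetric M a (Kerr.rPlus M a)).IsTimelike (x := QK) u) :=
      ⟨_, hERR QK YK hUQ hUY
        (LorentzianMetric.chronologicalFuture_subset_causalFuture (Kerr.smoothMetric M a (Kerr.rPlus M a)) τK {QK} hI') hneQ⟩
    have hut := hutime hI'
    obtain ⟨β, β', hβ'c, hβ0, hβ1, hβ⟩ := radial_coordCurve (a := a) hM.le QK u hudom hut hufut
    have hβ1' : β 1 = Y := by rw [hβ1]; exact congrArg Subtype.val huexp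
    have hβkin : ∀ r ∈ Icc (0:ℝ) 1, ‖β r - PK‖ ≤ 2 * h + 4 * (e * σ) := by
      intro r hr
      have hK := kerr_time_strictMonoOn_and_norm_sub_le M a (fun r ↦ Kerr.bilin M a (β r)) β 0 1 hM.le zero_le_one
        (fun r' hr' ↦ ⟨by simp, β' r', (hβ r' hr').2.1, (hβ r' hr').2.2.1.le, (hβ r' hr').2.2.2⟩)
      have hK' := (kerr_time_strictMonoOn_and_norm_sub_le M a (fun r ↦ Kerr.bilin M a (β r)) β 0 r hM.le hr.1
        (fun r' hr' ↦ ⟨by simp, β' r', (hβ r' ⟨hr'.1, hr'.2.trans hr.2⟩).2.1,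
          (hβ r' ⟨hr'.1, hr'.2.trans hr.2⟩).2.2.1.le, (hβ r' ⟨hr'.1, hr'.2.trans hr.2⟩).2.2.2⟩)).2
      have hmono : β r 0 ≤ β 1 0 := hK.1.monotoneOn hr (right_mem_Icc.2 zero_le_one) hr.2
      rw [hβ0] at hK'
      rw [hβ1', hY0] at hmono
      rw [hQ0] at hK'
      calc ‖β r - PK‖ ≤ ‖β r - QK‖ + ‖(QK : E4) - PK‖ := norm_sub_le_norm_sub_add_norm_sub _ _ _
        _ ≤ 2 * (β r 0 - (T - e * σ)) + 2 * (e * σ) := add_le_add hK' hQP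
        _ ≤ 2 * h + 4 * (e * σ) := by linarith [htI.2]
    have hthickβ : cthickening (η₀ / 2) (β '' Icc 0 1) ⊆ Ω := hthick _ (by
      rintro z ⟨r, hr, rfl⟩; linarith [hβkin r hr])
    obtain ⟨b, hbC, hblim⟩ := hanch (T - e * σ) ⟨by linarith, by linarith⟩
    have hblim' : Tendsto b l (𝓝 (β 0)) := by
      rw [hβ0]
      have : (T - e * σ) / e = T / e - σ := by field_simp
      rw [this] at hblim
      exact hblim
    exact transplant_contra (a := a) hM.le hΩext' hTL hεl hB hD β β' hβ'c (fun r hr ↦ (hβ r hr).2) (half_pos hη₀)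
      hthickβ b (fun n ↦ μ n t) hblim' (by rw [hβ1']; exact hYlim) hbC
      (by filter_upwards [hμ] with n hn; exact (hn t htI₀).2.1)
  /- ── (d) collinear: the flow property puts `Y` on the orbit, `t*` pins it ── -/
  · obtain ⟨c, hc, hcv⟩ := hcol
    obtain ⟨-, h0dom, -, hv0⟩ := maximalGeodesic_spec' (cov := (Kerr.smoothMetric M a (Kerr.rPlus M a)).leviCivita) PK (show TangentSpace 𝓘(ℝ, E4) PK from v)
    have hvel0 : (velocity 𝓘(ℝ, E4) (fun r : ℝ ↦ expMap (Kerr.smoothMetric M a (Kerr.rPlus M a)).leviCivita PK ((r • v : E4) : TangentSpace 𝓘(ℝ, E4) PK)) 0 : E4) = v :=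
      (velocity_expMap_smul (cov := (Kerr.smoothMetric M a (Kerr.rPlus M a)).leviCivita) PK (show TangentSpace 𝓘(ℝ, E4) PK from v) h0dom).trans hv0
    rw [hvel0] at hcv
    obtain ⟨-, hflow⟩ := orbit_flow M a r₀ hM ha0 haM h3 hcubic hmem (T / e) c
    have hYK' : YK = γK (T / e + c) := by
      rw [← hvexp, hcv]; exact hflow
    have hY : Y = Kerr.orbitCurve a r₀ √(M / r₀ ^ 3) (T / e + c) := congrArg Subtype.val hYK'
    have hc' : T / e + c = t / e := by
      have h0 := congrArg (fun z : E4 ↦ z 0) hY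
      simp only at h0
      rw [hY0, htime] at h0
      field_simp at h0 ⊢
      linarith
    rw [← hc']; exact hY

end NoC0

/-- **Registered sub-goal `stub_noC0_orbitFlow`** (NoC0KerrChart programme, crux `CaptureSufficesTame`, line
`only-the-third-law-is-generic`): the flow property along the photon orbit (`NoC0.orbit_flow`), verbatim. [cite: LeeRiemannianManifolds2018, Lemma 5.18] -/
theorem stub_noC0_orbitFlow :
    ∀ (M a r₀ : ℝ), ∀ [Kerr.Facts], ∀ [Kerr.SliceFacts], (0 < M) → (0 ≤ a) → (a ≤ M) → (3 * M ≤ r₀) → (r₀ * (r₀ - 3 * M) ^ 2 = 4 * a ^ 2 * M) → ∀ (hmem' : ∀ s, Kerr.orbitCurve a r₀ √(M / r₀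
      ^ 3) s ∈ Kerr.exterior M a), ∀ (s c : ℝ), ((c • (velocity 𝓘(ℝ, E4) (fun u ↦ (⟨Kerr.orbitCurve a r₀ √(M / r₀ ^ 3) u, hmem' u⟩ : Kerr.region a (Kerr.rPlus M a))) s : E4) : E4) :
      TangentSpace 𝓘(ℝ, E4) ((⟨Kerr.orbitCurve a r₀ √(M / r₀ ^ 3) s, hmem' s⟩ : Kerr.region a (Kerr.rPlus M a)))) ∈ expDomain (Kerr.smoothMetric M a (Kerr.rPlus M a)).leviCivita
      ((⟨Kerr.orbitCurve a r₀ √(M / r₀ ^ 3) s, hmem' s⟩ : Kerr.region a (Kerr.rPlus M a))) ∧ expMap (Kerr.smoothMetric M a (Kerr.rPlus M a)).leviCivita ((⟨Kerr.orbitCurve a r₀ √(M / r₀ ^ 3)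
      s, hmem' s⟩ : Kerr.region a (Kerr.rPlus M a))) ((c • (velocity 𝓘(ℝ, E4) (fun u ↦ (⟨Kerr.orbitCurve a r₀ √(M / r₀ ^ 3) u, hmem' u⟩ : Kerr.region a (Kerr.rPlus M a))) s : E4) : E4) :
      TangentSpace 𝓘(ℝ, E4) ((⟨Kerr.orbitCurve a r₀ √(M / r₀ ^ 3) s, hmem' s⟩ : Kerr.region a (Kerr.rPlus M a)))) = ⟨Kerr.orbitCurve a r₀ √(M / r₀ ^ 3) (s + c), hmem' (s + c)⟩ :=
  NoC0.orbit_flow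

end Summit.FinalStateConjecture.FinalStateConjecture.Theorems.PhaseMixingCaptureCaptureSufficesTame

end
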